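import Mathlib
import HarnessLib
import HarnessLib.Audit
import Summits.SmoothPoincare4.Statement
import Literature.Geometry.Lorentzian.PseudoRiemannianMetric
import Literature.Geometry.Lorentzian.LeviCivita
import Literature.Geometry.Lorentzian.Isometry
import HarnessLib.Audit.Status.Attr

/-!
Route: ChargedHalfTurns

DORMANT since 2026-08-24T05:08:39Z (reconciler: no traction for 6.6 d (last activity item-evidence-added at 2026-08-17T15:08:16Z); parked, not closed — `ledger route dormant route-SmoothPoincare4-ChargedHalfTurns --off` to reactivate) — unstaffed, not closed; items shared with open routes are served there. `ledger route dormant <id> --off` reactivates.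

# Route ChargedHalfTurns — charged half-turns — real Seiberg–Witten degree versus equivariant PSC on
S⁴ refutes SPC4

NEGATIVE-SIDE route (refutation form of the deciding theorem; lens negation-construct). A HALF-TURN
of a smooth 4-manifold is a smooth
involution ι whose fixed-point set is a smoothly embedded 2-sphere. It suffices to show X =
ChargedSphere ∧ InvolutionPSC.
ChargedSphere (SUPPLY, a theorem in print): some smooth homotopy 4-sphere M (literally the
Statement's binders) carries a half-turn ι such
that NO ι-invariant Riemannian metric on M has positive scalar curvature — Miyazawa's M = Σ₂(S⁴,
ρP(−2,3,7)) and Kuhrman's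
Σ₂(S⁴, ρK(2,3,|6s+1|)) with their deck involutions, whose real Seiberg–Witten degree |deg| = 3, 4j±1
≠ 1 forbids invariant PSC metrics.
InvolutionPSC (OBSTRUCTION, the bet — equivariant PSC rigidity of the standard sphere): on every
smooth 4-manifold diffeomorphic to S⁴
(any carrier and atlas) every half-turn preserves SOME metric of positive scalar curvature. Then
¬SmoothPoincare4: SPC4 would make the
charged M itself such a manifold. No card is realised (none exists on this mechanism).
Lean: `(∃ (M : Type) (_ : TopologicalSpace M) (_ : T2Space M) (_ : SecondCountableTopology M) (_ :
ChartedSpace (EuclideanSpace ℝ (Fin 4)) M) (_ : IsManifold (𝓡 4) ((⊤ : ℕ∞) : WithTop ℕ∞) M) (_ : M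
≃ₕ Metric.sphere (0 : EuclideanSpace ℝ (Fin 5)) 1) (ι : M → M) (e : Metric.sphere (0 :
EuclideanSpace ℝ (Fin 3)) 1 → M), ContMDiff (𝓡 4) (𝓡 4) ((⊤ : ℕ∞) : WithTop ℕ∞) ι ∧ ι ∘ ι = id ∧
Manifold.IsSmoothEmbedding (𝓡 2) (𝓡 4) ((⊤ : ℕ∞) : WithTop ℕ∞) e ∧ (∀ x, ι x = x ↔ x ∈ Set.range e)
∧ ∀ (g : Literature.Geometry.Lorentzian.PseudoRiemannianMetric (𝓡 4) ((⊤ : ℕ∞) : WithTop ℕ∞)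
(EuclideanSpace ℝ (Fin 4)) (TangentSpace (𝓡 4) : M → Type _)) (_ : g.HasLeviCivita), g.IsRiemannian
→ (∀ x, 0 < g.scalarCurvature x) → ¬ (∀ y, Literature.Geometry.Lorentzian.pullbackBilin (I := 𝓡 4)
(I' := 𝓡 4) ι g.val y = g.val y)) ∧ (∀ (M : Type) [TopologicalSpace M] [T2Space M]
[SecondCountableTopology M] [ChartedSpace (EuclideanSpace ℝ (Fin 4)) M] [IsManifold (𝓡 4) ((⊤ : ℕ∞)
: WithTop ℕ∞) M], Nonempty (Diffeomorph (𝓡 4) (𝓡 4) M (Metric.sphere (0 : EuclideanSpace ℝ (Fin 5))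
1) ((⊤ : ℕ∞) : WithTop ℕ∞)) → ∀ (ι : M → M) (e : Metric.sphere (0 : EuclideanSpace ℝ (Fin 3)) 1 →
M), ContMDiff (𝓡 4) (𝓡 4) ((⊤ : ℕ∞) : WithTop ℕ∞) ι → ι ∘ ι = id → Manifold.IsSmoothEmbedding (𝓡 2)
(𝓡 4) ((⊤ : ℕ∞) : WithTop ℕ∞) e → (∀ x, ι x = x ↔ x ∈ Set.range e) → ∃ (g :
Literature.Geometry.Lorentzian.PseudoRiemannianMetric (𝓡 4) ((⊤ : ℕ∞) : WithTop ℕ∞) (EuclideanSpace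
ℝ (Fin 4)) (TangentSpace (𝓡 4) : M → Type _)) (_ : g.HasLeviCivita), g.IsRiemannian ∧ (∀ x, 0 <
g.scalarCurvature x) ∧ ∀ y, Literature.Geometry.Lorentzian.pullbackBilin (I := 𝓡 4) (I' := 𝓡 4) ι
g.val y = g.val y)`

## Assembly
Pure logic, proved sorry-free in folder/Sketch.lean (`closes`, rc 0) and certified as glue.lean with
`--refutation`: assume SmoothPoincare4
(unfolded: ∀ M Hausdorff second countable, ∀ C^((⊤ : ℕ∞) : WithTop ℕ∞) atlas on ℝ⁴, M ≃ₕ S⁴ →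
Nonempty (M ≃ₘ S⁴)); ChargedSphere gives (M, e₄ : M ≃ₕ S⁴, ι, e)
with no ι-invariant PSC metric; SmoothPoincare4 at (M, e₄) gives Nonempty (M ≃ₘ S⁴); InvolutionPSC
at (M, ι, e) gives an ι-invariant
PSC metric — contradiction. CircleRung is a listed rung not used by `closes`.

Rationale: WHY THIS LINE. Miyazawa's real Seiberg–Witten degree (arXiv:2312.02041 Thm 1.8, Def 3.4; Tian–Wang,
Kato; developed by Baraglia arXiv:2504.00281) is
an invariant of a homotopy 4-sphere WITH INVOLUTION that is defined at b₂ = 0, is NOT forced (it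
takes every odd value on Kuhrman's
family, arXiv:2507.03798 Thms 1–3 with Kang–Park–Taniguchi arXiv:2405.09295), and obstructs
invariant positive scalar curvature
(Baraglia Prop 1.3(3), Miyazawa Prop 3.14): |deg| = 1 whenever the involution preserves a PSC
metric. Transporting a charged half-turn
along a putative diffeomorphism M ≅ S⁴ turns "exhibit an exotic S⁴" into an equivariant
PSC-EXISTENCE problem for ℤ/2-actions on the
STANDARD sphere, where tools live (Lawson–Yau, Bérard-Bergery, Hanke arXiv:math/0512284 equivariant
Gromov–Lawson surgery; Wiemeler
arXiv:1305.2288 Thm 1.1 for half-turns inside circle actions; orbifold/edge-cone metrics on (S⁴,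
2-knot)) — the dichotomy is stated
informally by Miyazawa (Thm 4.46) and Kuhrman (§5 Q1) and is typed here for the first time; imported
areas: real/Pin⁻(2) gauge theory
(as a certificate, not re-derived), equivariant positive scalar curvature, 2-knot theory (branched
double covers of twist-roll spun
knots, HKM arXiv:2402.11706). No other route of the summit uses an equivariant invariant as
exoticness certificate (RealQuotientSpheres
records the real SW degree "as context, not engine"; QuotientSpheres concludes about quotients of
S⁴, positively); negatives index empty.

RANKED CRUXES. #2 InvolutionPSC (crux) — for every smooth 4-manifold M diffeomorphic to S⁴ (any
carrier and atlas), every smooth involution ι : M → M whose fixed-point set is the image of a smooth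
embedding S² → M preserves some C^((⊤ : ℕ∞) : WithTop ℕ∞) Riemannian metric of positive scalar
curvature (g Riemannian with Levi-Civita connection, scal_g > 0 everywhere, ι^* g = g via the tree's
pullbackBilin). [difficulty: open-problem] (why it might fail: SPC4 itself refutes it (given
ChargedSphere): if Σ₂(S⁴,ρP(−2,3,7)) — a Gluck twist / torus surgery on S⁴ (Kuhrman Cor 2.9, Prop
4.4) — is standard, S⁴ has PSC-less half-turns; CP² already has such exotic involutions (Miyazawa
4.45 + HKM Cor 1.5).) [arXiv:2312.02041, arXiv:2507.03798, arXiv:2402.11706, arXiv:1305.2288,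
arXiv:math/0512284, arXiv:2504.00281]
#3 ChargedSphere (crux) — there is a smooth homotopy 4-sphere M (Hausdorff, second countable, C^((⊤
: ℕ∞) : WithTop ℕ∞) atlas on ℝ⁴, M ≃ₕ S⁴) with a smooth involution ι whose fixed-point set is the
image of a smooth embedding S² → M, such that no ι-invariant Riemannian metric on M has everywhere
positive scalar curvature (in print: M = Σ₂(S⁴, ρP(−2,3,7)) with its deck involution, |deg| = 3).
[difficulty: XL] (why it might fail: rests on preprints: Miyazawa Thm 4.44 (simple connectivity),
Thm 4.32 (|deg(τ_(0,1)P(−2,3,7))| = 3 via MOY spectral flow) and the PSC vanishing Prop 3.14 /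
Baraglia Prop 1.3(3) (needs the involution ODD = Real spin); a gap there voids the supply.)
[arXiv:2312.02041, arXiv:2507.03798, arXiv:2504.00281, arXiv:2405.09295]
#9 CircleRung (support) — (Wiemeler 2016 Thm 1.1, G = S¹, no dimension restriction) a closed
connected smooth 4-manifold with an effective smooth circle action that fixes pointwise a smoothly
embedded 2-sphere carries an S¹-invariant metric of positive scalar curvature; it yields
InvolutionPSC for the half-turns x ↦ (−1)•x inside such actions (the linear half-turns of S⁴).
[difficulty: XL] [arXiv:1305.2288, Fintushel1978, Pao1978]

TWO-LAYER PLAN. Foreseen glued split of InvolutionPSC (registered as its birth skeleton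
bc/InvolutionPSC_birth.lean, not filed): InvolutionPSC ⇐
QuotientStandard (the orbit space of a half-turn of a standard sphere is a smooth 4-manifold
diffeomorphic to S⁴ — the quotient
construction plus route QuotientSpheres' InvolutionQuotient, a shared item in spirit) → DeckPSC
(deck involutions of 2-knots S ⊂ S⁴ with
Σ₂(S) ≅ S⁴ preserve PSC, i.e. (S⁴, S) carries a PSC orbifold metric with cone angle π) →
InvolutionPSC. Of ChargedSphere
(bc/ChargedSphere_birth.lean): FixedSphere (fold covers along 2-knots have fixed set an embedded S²)
→ ChargedCover (Kuhrman Thm 3 with the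
branched-cover data) → ChargedSphere.

KILL CRITERIA. (i) A proof that Σ₂(S⁴, ρP(−2,3,7)) ≅ S⁴ (HKM Question 1.4 = Kuhrman Question 1; it
is the Gluck twist of S⁴ along the lift of the twin sphere
of τ²ρ¹P(−2,3,7), and a single torus surgery on S⁴) REFUTES InvolutionPSC: close
`refuted:InvolutionPSC`, and the refuting theorem is
itself the headline "S⁴ admits infinitely many half-turns preserving no PSC metric" (Miyazawa Thm
4.46, second branch). (ii) A computation
|deg(τ_k K)| ≠ 1 for one ODD k (where Σ₂(τ_k K) ≅ S⁴ by Zeeman + HKM Thm 1.1) refutes InvolutionPSC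
likewise. (iii) A retraction of
Miyazawa Thm 4.32/4.44 or of the PSC vanishing voids ChargedSphere: close `refuted:ChargedSphere`
unless Kuhrman's K(2,3,|6s+1|) family
survives independently. (iv) SPC4 proved elsewhere moots the route and converts InvolutionPSC's
negation into a theorem about Diff(S⁴).

NOT DECOMPOSED YET. The quotient/deck split of InvolutionPSC (layer 2, above); the Giffen rung (deck
involutions of S⁴ over odd twist spins — the first
non-linear instances — preserve PSC: via the lifted linear (k,1)-weight circle symmetry of (S⁴, τ_k
K) and Wiemeler/Hanke equivariant
surgery) and the linear rung (round metric) are filed informally after open; the specific kill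
statements KuhrmanSphereStandard and
OddTwistDegreeOne are filed informally (the roll-spun/twist-spun 2-knots are not typed in the tree).
Vendoring Miyazawa's degree is NOT
attempted: the supply crux is stated without the invariant (only its PSC consequence), so no real
Seiberg–Witten theory enters any signature.

CHEAPEST FALSIFIER. RUN this session (lookup): do the KNOWN-standard members of the twist-roll-spun
family carry charge ≠ 1? By HKM Thm 1.1 / Remark 1.3(2)
Σ₂(τ^m ρ¹ P(−2,3,7)) ≅ S⁴ exactly for m ≡ 2 (mod 4) (18-surgery on P(−2,3,7) is a lens space,
Teragaito), and Miyazawa Thm 4.32 gives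
|deg(τ_(k,α))| = 1 iff k/2 + α is even, i.e. |deg| = 1 precisely for k ≡ 2 (mod 4) when α = 1: the
degree-1 members are exactly the standard
ones and the charged members (k ≡ 0 mod 4, including Miyazawa's k = 0) are exactly those of unknown
diffeotype — InvolutionPSC passes. The
next cheapest kill is a real-Frøyshov computation of |deg(τ_k P(−2,3,7))| for one odd k (Miyazawa
computed even k only; Melvin's Kirby
Problem 4.58 sits here), or Kirby calculus on the explicit Gluck-twist / torus-surgery description
of Σ₂(S⁴, ρP(−2,3,7)).

NUMBERS. |deg(unknot)| = 1, |deg(P₊)| = 1, |deg(P₋)| = 0 (Miyazawa Prop 3.14, 4.33); |deg(τ_(k,α)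
P(−2,3,7))| = 1 or 3 according to k/2+α even/odd,
k even (Thm 4.32); |deg(K(2,3,|6s+1|))| = 4j−1 for |6s+1| ∈ {12j−1, 12j−5}, 4j+1 for |6s+1| ∈
{12j+1, 12j+5} (KPT, Kuhrman §4);
Σ₂(τ^mρ^nK) ≅ Σ₂(τ^(m+4)ρ^nK) (HKM Thm 1.1); Σ₂(τ_m K) ≅ S⁴ for m odd (Zeeman + HKM). Items at open:
4 (2 cruxes, 1 support, assembly).

DEFINITION REQUESTS. None needed for the typed items (PseudoRiemannianMetric, scalarCurvature,
pullbackBilin, IsSmoothEmbedding exist). Wanted later, for the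
informal kill items: twist-roll spun 2-knots τ^m ρ^n K ⊂ S⁴ (Litherland/Plotnick) and branched
double covers of S⁴ along 2-knots
(Literature/Topology/FourManifolds); a cite fact for Wiemeler 2016 Thm 1.1
(Literature/Geometry/Riemannian).

Novelty: Searches (2026-08-17): zbMATH `Price twist` (7; Kim–Miller 1805.00429, Isoshima–Suzuki 2505.09332),
`real Seiberg-Witten invariant surfaces` (8; Baraglia 2504.00281, Miyazawa 2312.02041,
Baraglia–Hekmati 2403.00203, KMT 2409.07287), `Gluck twist` ≥2015 (12; Kuhrman 2507.03798, GNS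
2307.06388, Naylor–Schwartz 2009.05703, KPR 2206.14113), `homotopy 4-sphere standard` (11; HKM,
Cha–Kim 2411.10051, Oliveira-Smith 2603.23717, Gerig 1905.10938), `branched covers twist-roll spun
knots` (1), `exotic involutions 4-sphere` (0), `circle actions scalar curvature Wiemeler` (1),
`knotting corks`/`cork twist homotopy 4-sphere` (3); `lit read` of arXiv:2507.03798 (pp.1–6, 19,
24–28), 2312.02041 (pp.2–5, 24, 29–45), 2504.00281 (pp.2–5), 2402.11706 (pp.1–4), 1305.2288 (p.3),
0812.5098 (p.10); `lit galaxy search "Price twist" --star all` (12 junk); grep of all 59 Theses and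
160 idea cards for Miyazawa / real SW / roll-spun / equivariant PSC (hits only as context:
RealQuotientSpheres, antipodal-dissolution, dissolve-then-descend-cp2 closed); arXiv, S2 and
OpenAlex APIs rate-limited all session (logged).
Nearest prior art found: arXiv:2312.02041 Thm 4.46 and arXiv:2507.03798 §5 Q1 (the dichotomy "exotic
S⁴ or PSC-less ℤ/2-actions on S⁴", informal); arXiv:2402.11706 Q1.4 (is Σ₂(τ⁰ρ¹P(−2,3,7)) ≅ S⁴?); on
the summit, route RealQuotientSpheres (real SW degree recorded as context) and QuotientSpheres
(involutions on the standard S⁴, quotient side).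
Delta: the printed dichotomy is turned into a typed r  [refs: 2507.03798, 2312.02041, 2402.11706]

Barriers (technique_class: real-SW-charge, equivariant-PSC, branched-covers): - technique_class: real-SW-charge, equivariant-PSC, branched-covers
- Literature.Barriers.SmoothPoincare4.GaugeSumBarrierFour: evaded — no invariant of Σ alone is used;
the real SW degree is an invariant of the PAIR (Σ, ι), defined at b₂⁺ = 0 and not forced (all odd
values occur), outside the class `IsHomotopySphereSumStable` (D.4's recorded escape "invariants at
b₂⁺ = 0 not sum-stable; finite-group symmetry with fixed points").
- Literature.Barriers.SmoothPoincare4.CircleActionBarrierFour: consistent and USED as the rung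
structure — half-turns inside effective circle actions are the sector where InvolutionPSC holds
(CircleRung, Wiemeler); the charged half-turns extend to no such action (else Σ ≅ S⁴ by
Fintushel–Pao AND PSC-symmetric, contradicting |deg| ≥ 3), so the supply lives exactly outside the
barrier's class.
- Literature.Barriers.SmoothPoincare4.ProjectiveRigidityBarrierFour: not met — the involutions have
fixed set S² and are orientation-preserving; nothing is claimed about free involutions or quotients
≃ ℝℙ⁴.
- Literature.Barriers.SmoothPoincare4.GluckTwistCP2Barrier: relevant and conceded —
Σ₂(S⁴,ρP(−2,3,7)) IS a Gluck twist on S⁴ (Kuhrman Cor 2.9), so it dissolves in ℂℙ² and every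
ℂℙ²-cancellative invariant and the FGMW s-strategy are blind on it (MMSW Cor 1.13): this candidate
is invisible to ZeroSurgeryExotic's engine, which is why a non-cancellative certificate (the charge
of the pair) is needed; conversely the CP² analogue of InvolutionPSC is FALSE (HKM Cor 1.

History (route lifecycle, newest last):
- 2026-08-17T02:29:12Z · rev 1: dropped stmt-SmoothPoincare4-18323, stmt-SmoothPoincare4-18324 — drop two placeholder informal items (KuhrmanSphereStandard stmt-18323, OddTwistDegreeOne stmt-18324) created by an id re-query with placeholder text; superseded (planner-plan-lens3-SmoothPoincare4-negation-0)
- 2026-08-17T02:30:07Z · rev 2: dropped stmt-SmoothPoincare4-18307, stmt-SmoothPoincare4-18350, stmt-SmoothPoincare4-18359 — dedup: drop three duplicate informal items created while re-querying ids (18307 = second GiffenRung; 18350/18359 = renamed copies of KuhrmanSphereStandard stmt- (planner-plan-lens3-SmoothPoincare4-negation-0)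
- 2026-08-24T05:08:39Z · DORMANT — reconciler: no traction for 6.6 d (last activity item-evidence-added at 2026-08-17T15:08:16Z); parked, not closed — `ledger route dormant route-SmoothPoincare4- (operator:999:3140535)

sub-problem: SmoothPoincare4 · status: dormant · opened planner-plan-lens3-SmoothPoincare4-negation-0 2026-08-17T02:23:54Z · rev 4 · ledger route-SmoothPoincare4-ChargedHalfTurns
GENERATED by the gate from the ledger (D-0016/17). Provers cite these decls: `theorem foo : Summit.SmoothPoincare4.SmoothPoincare4.Theses.ChargedHalfTurns.<Decl> := …` in Summits/SmoothPoincare4/SmoothPoincare4/Theorems/<Name>.lean.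
-/

namespace Summit.SmoothPoincare4.SmoothPoincare4.Theses.ChargedHalfTurns

open scoped BigOperators Topology Manifold Classical MeasureTheory ProbabilityTheory Matrix InnerProductSpace ComplexConjugate ContinuousMap
open Filter Set Function TopologicalSpace MeasureTheory

attribute [summit_statement] _root_.SmoothPoincare4

open Literature.SPC4

/-- item stmt-SmoothPoincare4-18211 · crux · rank 2 · open · by planner
why it might fail: SPC4 itself refutes it (given ChargedSphere): if Σ₂(S⁴,ρP(−2,3,7)) — a Gluck twist / torus surgery on S⁴ (Kuhrman Cor 2.9, Prop 4.4) — is standard, S⁴ has PSC-less half-turns; CP² already has such exotic involutions (Miyazawa 4.45 + HKM Cor 1.5).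
sources: arXiv:2312.02041, arXiv:2507.03798, arXiv:2402.11706, arXiv:1305.2288, arXiv:math/0512284, arXiv:2504.00281
[crux] for every smooth 4-manifold M diffeomorphic to S⁴ (any carrier and atlas), every smooth
involution ι : M → M whose fixed-point set is the image of a smooth embedding S² → M preserves some
C^((⊤ : ℕ∞) : WithTop ℕ∞) Riemannian metric of positive scalar curvature (g Riemannian with
Levi-Civita connection, scal_g > 0 everywhere, ι^* g = g via the tree's pullbackBilin). [difficulty:
open-problem] -/
@[route_item "route-SmoothPoincare4-ChargedHalfTurns", crux]
def InvolutionPSC : Prop :=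
  ∀ (M : Type) [TopologicalSpace M] [T2Space M] [SecondCountableTopology M] [ChartedSpace (EuclideanSpace ℝ (Fin 4)) M] [IsManifold (𝓡 4) ((⊤ : ℕ∞) : WithTop ℕ∞) M], Nonempty (Diffeomorph (𝓡 4) (𝓡 4) M (Metric.sphere (0 : EuclideanSpace ℝ (Fin 5)) 1) ((⊤ : ℕ∞) : WithTop ℕ∞)) → ∀ (ι : M → M) (e : Metric.sphere (0 : EuclideanSpace ℝ (Fin 3)) 1 → M), ContMDiff (𝓡 4) (𝓡 4) ((⊤ : ℕ∞) : WithTop ℕ∞) ι → ι ∘ ι = id → Manifold.IsSmoothEmbedding (𝓡 2) (𝓡 4) ((⊤ : ℕ∞) : WithTop ℕ∞) e → (∀ x, ι x = x ↔ x ∈ Set.range e) → ∃ (g : Literature.Geometry.Lorentzian.PseudoRiemannianMetric (𝓡 4) ((⊤ : ℕ∞) : WithTop ℕ∞) (EuclideanSpace ℝ (Fin 4)) (TangentSpace (𝓡 4) : M → Type _)) (_ : g.HasLeviCivita), g.IsRiemannian ∧ (∀ x, 0 < g.scalarCurvature x) ∧ ∀ y, Literature.Geometry.Lorentzian.pullbackBilin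 (I := 𝓡 4) (I' := 𝓡 4) ι g.val y = g.val y

/-- item stmt-SmoothPoincare4-18212 · crux · rank 3 · open · by planner
why it might fail: rests on preprints: Miyazawa Thm 4.44 (simple connectivity), Thm 4.32 (|deg(τ_(0,1)P(−2,3,7))| = 3 via MOY spectral flow) and the PSC vanishing Prop 3.14 / Baraglia Prop 1.3(3) (needs the involution ODD = Real spin); a gap there voids the supply.
sources: arXiv:2312.02041, arXiv:2507.03798, arXiv:2504.00281, arXiv:2405.09295
[crux] there is a smooth homotopy 4-sphere M (Hausdorff, second countable, C^((⊤ : ℕ∞) : WithTop ℕ∞)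
atlas on ℝ⁴, M ≃ₕ S⁴) with a smooth involution ι whose fixed-point set is the image of a smooth
embedding S² → M, such that no ι-invariant Riemannian metric on M has everywhere positive scalar
curvature (in print: M = Σ₂(S⁴, ρP(−2,3,7)) with its deck involution, |deg| = 3). [difficulty: XL] -/
@[route_item "route-SmoothPoincare4-ChargedHalfTurns", crux]
def ChargedSphere : Prop :=
  ∃ (M : Type) (_ : TopologicalSpace M) (_ : T2Space M) (_ : SecondCountableTopology M) (_ : ChartedSpace (EuclideanSpace ℝ (Fin 4)) M) (_ : IsManifold (𝓡 4) ((⊤ : ℕ∞) : WithTop ℕ∞) M) (_ : M ≃ₕ Metric.sphere (0 : EuclideanSpace ℝ (Fin 5)) 1) (ι : M → M) (e : Metric.sphere (0 : EuclideanSpace ℝ (Fin 3)) 1 → M), ContMDiff (𝓡 4) (𝓡 4) ((⊤ : ℕ∞) : WithTop ℕ∞) ι ∧ ι ∘ ι = id ∧ Manifold.IsSmoothEmbedding (𝓡 2) (𝓡 4) ((⊤ : ℕ∞) : WithTop ℕ∞) e ∧ (∀ x, ι x = x ↔ x ∈ Set.range e) ∧ ∀ (g : Literature.Geometry.Lorentzian.PseudoRiemannianMetric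 (𝓡 4) ((⊤ : ℕ∞) : WithTop ℕ∞) (EuclideanSpace ℝ (Fin 4)) (TangentSpace (𝓡 4) : M → Type _)) (_ : g.HasLeviCivita), g.IsRiemannian → (∀ x, 0 < g.scalarCurvature x) → ¬ (∀ y, Literature.Geometry.Lorentzian.pullbackBilin (I := 𝓡 4) (I' := 𝓡 4) ι g.val y = g.val y)

-- item stmt-SmoothPoincare4-18257 · support · rank 4 · open · by planner — informal only, no Lean statement yet:
--   [crux] GIFFEN RUNG (first non-linear instances of InvolutionPSC): for every classical knot K and
--   every ODD k, the deck involution of the standard 4-sphere S⁴ = Σ₂(S⁴, τ_k K) (Zeeman: τ_{±1}K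
--   unknotted; Hughes–Kim–Miller arXiv:2402.11706 Thm 1.1: Σ₂(τ^mρ^nK) ≅ Σ₂(τ^{m+4}ρ^nK)) — whose fixed
--   set is the branched twist spin, a KNOTTED 2-sphere (Giffen 1966, Gordon, Plotnick) — preserves some
--   Riemannian metric of positive scalar curvature; equivalently (S⁴, τ_k K) carries a PSC orbifold
--   metric with cone angle π along the knot. Why it might fail: the natural symmetry (the linear
--   (k,1)-weight circle

-- item stmt-SmoothPoincare4-18258 · support · rank 5 · open · by planner — informal only, no Lean statement yet:
--   [crux][kill switch — its PROOF refutes InvolutionPSC and closes the route refuted:InvolutionPSC; its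
--   DISPROOF is an exotic S⁴] The homotopy 4-sphere Σ₂(S⁴, ρP(−2,3,7)) = Σ₂(S⁴, τ⁰ρ¹P(−2,3,7)) (Miyazawa
--   arXiv:2312.02041 Thm 4.44; |deg| = 3 by Thm 4.32) is diffeomorphic to S⁴. Explicit descriptions
--   available to a refuter: it is the GLUCK TWIST of S⁴ = Σ₂(S⁴, τ²ρ¹P(−2,3,7)) (standard: HKM
--   arXiv:2402.11706 Rem 1.3(2), 18-surgery on P(−2,3,7) is a lens space) along the lift of the twin
--   sphere (Kuhrman arXiv:2507.03798 Thm 4 / Cor 2.9), and a single nontrivial TORUS SURGERY on S⁴ along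
--   a turned tref

-- item stmt-SmoothPoincare4-18259 · support · rank 6 · open · by planner — informal only, no Lean statement yet:
--   [crux][cheapest falsifier of InvolutionPSC, refuter-facing] For every classical knot K and every odd
--   integer k, Miyazawa's real Seiberg–Witten degree of the k-twist-spun 2-knot satisfies
--   |deg(τ_{k,0}(K))| = 1 (arXiv:2312.02041 Def 3.4 / Thm 1.8; defined since Σ₂(S⁴, τ_k K) is an integer
--   homology 4-sphere, Kuhrman Lemma 2.3, indeed ≅ S⁴ for k odd). InvolutionPSC implies it (Baraglia
--   arXiv:2504.00281 Prop 1.3(3): an involution preserving a PSC metric has |deg| = 1); Miyazawa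
--   computed |deg(τ_{k,α}P(−2,3,7))| ∈ {1,3} for EVEN k only (Thm 4.32, via the product formula Σ₂ = P̃
--   ∪ X̃_K of Cor 4.18 whi

/-- item stmt-SmoothPoincare4-18213 · support · rank 9 · open · by planner
sources: arXiv:1305.2288, Fintushel1978, Pao1978
[support] (Wiemeler 2016 Thm 1.1, G = S¹, no dimension restriction) a closed connected smooth
4-manifold with an effective smooth circle action that fixes pointwise a smoothly embedded 2-sphere
carries an S¹-invariant metric of positive scalar curvature; it yields InvolutionPSC for the
half-turns x ↦ (−1)•x inside such actions (the linear half-turns of S⁴). [difficulty: XL] -/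
@[route_item "route-SmoothPoincare4-ChargedHalfTurns"]
def CircleRung : Prop :=
  ∀ (M : Type) [TopologicalSpace M] [T2Space M] [SecondCountableTopology M] [ChartedSpace (EuclideanSpace ℝ (Fin 4)) M] [IsManifold (𝓡 4) ((⊤ : ℕ∞) : WithTop ℕ∞) M] [CompactSpace M] [ConnectedSpace M] [MulAction Circle M], FaithfulSMul Circle M → ContMDiffSMul (𝓡 1) (𝓡 4) ((⊤ : ℕ∞) : WithTop ℕ∞) Circle M → (∃ e : Metric.sphere (0 : EuclideanSpace ℝ (Fin 3)) 1 → M, Manifold.IsSmoothEmbedding (𝓡 2) (𝓡 4) ((⊤ : ℕ∞) : WithTop ℕ∞) e ∧ ∀ x ∈ Set.range e, ∀ z : Circle, z • x = x) → ∃ (g : Literature.Geometry.Lorentzian.PseudoRiemannianMetric (𝓡 4) ((⊤ : ℕ∞) : WithTop ℕ∞) (EuclideanSpace ℝ (Fin 4)) (TangentSpace (𝓡 4) : M → Type _)) (_ : g.HasLeviCivita), g.IsRiemannian ∧ (∀ x, 0 < g.scalarCurvature x) ∧ ∀ (z : Circle) (y : M), Literature.Geometry.Lorentzian.pullbackBilin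 (I := 𝓡 4) (I' := 𝓡 4) (fun x : M => z • x) g.val y = g.val y

/-- item stmt-SmoothPoincare4-18214 · assembly · rank 1 · open · by planner
sources: arXiv:2312.02041, arXiv:2507.03798
[assembly] ChargedSphere → InvolutionPSC → ¬ SmoothPoincare4. -/
@[route_item "route-SmoothPoincare4-ChargedHalfTurns"]
def Assembly : Prop :=
  ChargedSphere → InvolutionPSC → ¬ _root_.SmoothPoincare4

/-! D-0027 §2.1 — DECIDING THEOREM (planner-authored via `route open/edit --closes-file`; by planner-plan-lens3-SmoothPoincare4-negation-0 2026-08-17T02:23:54Z):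
its hypotheses are this route's items and its conclusion the sub-problem Statement (glue_lint), and it elaborates with this file. -/

@[closes "route-SmoothPoincare4-ChargedHalfTurns"] theorem closes (hC : ChargedSphere) (hR : InvolutionPSC) : ¬ _root_.SmoothPoincare4 := by
  intro hS
  have hS' : ∀ (M : Type) [TopologicalSpace M] [T2Space M] [SecondCountableTopology M],
      ContinuousMap.HomotopyEquiv.NonemptyDiffeomorphSphere M 4 := hS
  obtain ⟨M, _, _, _, _, _, e4, ι, e, hι, hinv, he, hfix, hno⟩ := hC
  obtain ⟨g, hg, hRiem, hpsc, hisom⟩ := hR M (hS' M ‹_› ‹_› e4) ι e hι hinv he hfix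
  exact hno g hg hRiem hpsc hisom

end Summit.SmoothPoincare4.SmoothPoincare4.Theses.ChargedHalfTurns
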